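import Literature.NumberTheory.EllipticCurves.BinaryQuarticForms
import HarnessLib

/-!
# Bhargava–Shankar, Theorem 5.6 (the `2`-Selmer parametrization): its printed inputs —
# the Birch–Swinnerton-Dyer correspondence and the minimisation lemmas at `p ≥ 5`, `3`, `2`

Topic `Literature/NumberTheory/EllipticCurves`. Third file of the decomposition of the named fact
`Literature.NumberTheory.EllipticCurves.averageRankLE_three_halves` (`BSDWave0.lean`): the printed inputs of the `2`-Selmer
parametrization `Literature.NumberTheory.EllipticCurves.bhargavaShankar_card_selmerTwo_eq` (Thm 5.6 of the held text, vendored in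
`BinaryQuarticForms.lean`), from which the companion `BinaryQuarticMinimisationProofs.lean`
re-proves Thm 5.6 following the printed proof (p. 32 of the held text).

Source: M. Bhargava, A. Shankar, *Binary quartic forms having bounded invariants, and the
boundedness of the average rank of elliptic curves*, Ann. of Math. (2) 181 (2015) 191–242,
doi:10.4007/annals.2015.181.1.3, §5.1. **Numbering caveat** (as in `BinaryQuarticForms.lean`):
lemma and page numbers are those of the held arXiv text `arXiv:1006.1002v2`, whose §5 is "The mean
size of the `2`-Selmer group of elliptic curves" (§3 of the published version). Lemmas 5.3, 5.4
and 5.5 there are quoted from B. J. Birch, H. P. F. Swinnerton-Dyer, *Notes on elliptic curves. I*,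
J. reine angew. Math. 212 (1963) 7–25, Lemmas 3, 4 and 5 ("We now recall the following facts which
are Lemmas 3, 4, and 5 of [BSD]"); Lemma 5.2 is attributed there to [BSD] "and the discussion
following it".

## The printed proof of Theorem 5.6 (held text, p. 32) and what is vendored here

Terminology of §5.1: two binary quartic forms `f₁`, `f₂` over a field `K` are *`K`-equivalent* if
`f₁ = μ²(γ · f₂)` for some `μ ∈ K` (nonzero) and `γ ∈ GL₂(K)` (`Literature.NumberTheory.EllipticCurves.BinaryQuartic.KEquiv`); over
`K = ℚ` one says *equivalent*. An integral form is *locally soluble* if `z² = f(x,y)` is soluble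
over `ℝ` and over every `ℚ_p` (`Literature.NumberTheory.EllipticCurves.BinaryQuartic.IsLocallySoluble`). For `E = E(A,B) : y² = x³ +
Ax + B` (`p⁴ ∤ A` or `p⁶ ∤ B`), `I(E) = −3A`, `J(E) = −27B` (§5, p. 31).

1. **Lemma 5.2 and the sentence following the definition of local solubility** (p. 31): "if
   `E/ℚ` is an elliptic curve having invariants `I` and `J`, then the set of elements in the
   `2`-Selmer group of `E` is in bijective correspondence with the set of equivalence classes of
   locally soluble integral binary quartic forms having invariants `λ⁴I` and `λ⁶J` for some
   `λ ∈ ℚ`." Vendored as the named fact `bhargavaShankar_card_selmerTwo_eq_kEquivClassCount`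
   (equality of cardinalities; `λ ≠ 0`, see the docstring). This is the cohomological content
   (`2`-coverings, [BSD] Lemmas 1–2, Cassels), not provable from the tree at present.
2. **Lemmas 5.3, 5.4, 5.5** ([BSD] Lemmas 3, 4, 5): an integral form with invariants `I`, `J`,
   soluble over `ℚ_p`, with `p⁴ ∣ I`, `p⁶ ∣ J` (`p ≥ 5`), resp. `3⁵ ∣ I`, `3⁹ ∣ J` (`p = 3`), resp.
   `2⁶ ∣ I`, `2⁹ ∣ J`, `2¹⁰ ∣ 8I + J` (`p = 2`), is equivalent to an integral form with invariants
   `p⁻⁴I`, `p⁻⁶J`. Vendored as the named facts `bsd_minimisation_prime_five_le`,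
   `bsd_minimisation_three`, `bsd_minimisation_two` (elementary but intricate explicit reductions
   in [BSD]; provable later independently of everything else).
3. **Proof of Thm 5.6 from 1–2** (p. 32): clear denominators (`f ↦ 4q²f` makes `λ ∈ 2ℤ`), remove
   the primes `p ≥ 5`, then `3` (using `3 ∣ I(E)`, `27 ∣ J(E)`), then the excess powers of `2`
   from `λ` by the three lemmas, reaching invariants exactly `2⁴I(E)`, `2⁶J(E)`; and "two integral
   binary quartic forms having the same invariants are equivalent if and only if they are
   `PGL₂(ℚ)`-equivalent". This step is *proved* in the companion file
   (`bhargavaShankar_card_selmerTwo_eq_of_facts`).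

## Contents

* `Literature.BinaryQuartic.kEquivClassCount S`: the number of (`ℚ`-)equivalence classes met by a set
  `S` of integral forms (same shape as `pgl2QClassCount`, with `KEquiv` for `PGL2Equiv`).
* The four named facts of items 1–2.

## Design choices

* As in `BinaryQuarticForms.lean`, "number of equivalence classes" of a set `S` of integral forms
  is the `Set.ncard` of the set of traces `{g ∈ S | f ∼ g}`, `f ∈ S`, forms being compared in
  `V_ℚ` after `map (Int.castRingHom ℚ)`.
* "`f'` has invariants `p⁻⁴I` and `p⁻⁶J`" is written `p⁴ · I(f') = I(f) ∧ p⁶ · J(f') = J(f)`.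
* `ℚ_p`-solubility of an integral `f` is `(f.map (Int.castRingHom ℚ_[p])).IsSoluble`, exactly the
  `p`-component of `IsLocallySoluble`.
-/

noncomputable section

open scoped Classical

namespace Literature.NumberTheory.EllipticCurves

namespace BinaryQuartic

/-! ### Counting `ℚ`-equivalence classes -/

/-- The number of (`ℚ`-)equivalence classes (`KEquiv` over `ℚ`: `g = μ²(γ · f)`, `μ ∈ ℚˣ`,
`γ ∈ GL₂(ℚ)`) met by a set `S` of integral binary quartic forms — the `Set.ncard` of the set of
traces on `S` of the classes (Bhargava–Shankar, held arXiv text §5.1: "if two binary quartic forms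
over `ℚ` are `ℚ`-equivalent, then we simply say that they are equivalent").
[cite: BhargavaShankarAnnals2015, §5.1 (equivalence of forms; arXiv:1006.1002v2 numbering)] -/
def kEquivClassCount (S : Set (BinaryQuartic ℤ)) : ℕ :=
  ((fun f ↦ {g | g ∈ S ∧ KEquiv (f.map (Int.castRingHom ℚ)) (g.map (Int.castRingHom ℚ))}) ''
    S).ncard

/-- Unfolding `kEquivClassCount`. [folklore] -/
theorem kEquivClassCount_eq (S : Set (BinaryQuartic ℤ)) :
    kEquivClassCount S = ((fun f ↦ {g | g ∈ S ∧
      KEquiv (f.map (Int.castRingHom ℚ)) (g.map (Int.castRingHom ℚ))}) '' S).ncard := rfl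

/-- The empty set of forms meets no class. [folklore] -/
@[simp] theorem kEquivClassCount_empty : kEquivClassCount ∅ = 0 := by
  simp [kEquivClassCount]

end BinaryQuartic

open BinaryQuartic

/-! ### Named facts (Bhargava–Shankar 2015, §5.1 of the held arXiv text) -/

/-- **The Birch–Swinnerton-Dyer correspondence** (Bhargava–Shankar, held arXiv text §5.1,
Lemma 5.2 and the sentence following the definition of locally soluble forms, p. 31; from
Birch–Swinnerton-Dyer, *Notes on elliptic curves. I* (1963) "and the discussion following it"):
"if `E/ℚ` is an elliptic curve having invariants `I` and `J`, then the set of elements in the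
`2`-Selmer group of `E` is in bijective correspondence with the set of equivalence classes of
locally soluble integral binary quartic forms having invariants `λ⁴I` and `λ⁶J` for some `λ ∈ ℚ`."
Here `E = E_{A,B}` with `(A, B)` in the height family, `I = I(E) = −3A`, `J = J(E) = −27B` (§5,
p. 31), "equivalence" is `ℚ`-equivalence (`KEquiv`), the Selmer group is the tree's cohomological
`WeierstrassCurve.selmerGroup _ 2`, and the correspondence is rendered as an equality of
cardinalities. The scalar `λ` is taken nonzero: the forms arising from `2`-coverings (Lemma 5.2)
have nonzero discriminant, as `E` does, whereas `λ = 0` would admit the degenerate forms with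
`I = J = 0`. [cite: BhargavaShankarAnnals2015, Lemma 5.2 and §5.1 p. 31 (arXiv:1006.1002v2 numbering)] -/
def bhargavaShankar_card_selmerTwo_eq_kEquivClassCount : Prop :=
  ∀ AB : ℤ × ℤ, IsInHeightFamily AB →
    Nat.card ((shortWeierstrass AB).selmerGroup 2) =
      kEquivClassCount {f : BinaryQuartic ℤ | f.IsLocallySoluble ∧ ∃ t : ℚ, t ≠ 0 ∧
        (f.I : ℚ) = t ^ 4 * (-3 * AB.1) ∧ (f.J : ℚ) = t ^ 6 * (-27 * AB.2)}

/-- **Minimisation at a prime `p ≥ 5`** (Bhargava–Shankar, held arXiv text, Lemma 5.3 =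
Birch–Swinnerton-Dyer (1963), Lemma 3): "Let `f` be an integral binary quartic form having
invariants `I` and `J`. Let `p ≥ 5` be a prime such that `p⁴ ∣ I`, `p⁶ ∣ J`, and the equation
`z² = f(x,y)` has a solution over `ℚ_p`. Then there exists an integral binary quartic form `f'`
equivalent to `f` having invariants `p⁻⁴I` and `p⁻⁶J`." ("Equivalent" = `ℚ`-equivalent, §5.1.)
[cite: BhargavaShankarAnnals2015, Lemma 5.3 (arXiv:1006.1002v2 numbering)] -/
def bsd_minimisation_prime_five_le : Prop :=
  ∀ (p : ℕ) [Fact p.Prime], 5 ≤ p → ∀ f : BinaryQuartic ℤ,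
    (p : ℤ) ^ 4 ∣ f.I → (p : ℤ) ^ 6 ∣ f.J → (f.map (Int.castRingHom ℚ_[p])).IsSoluble →
      ∃ f' : BinaryQuartic ℤ,
        KEquiv (f.map (Int.castRingHom ℚ)) (f'.map (Int.castRingHom ℚ)) ∧
          (p : ℤ) ^ 4 * f'.I = f.I ∧ (p : ℤ) ^ 6 * f'.J = f.J

/-- **Minimisation at `3`** (Bhargava–Shankar, held arXiv text, Lemma 5.4 = Birch–Swinnerton-Dyer
(1963), Lemma 4): "Let `f` be an integral binary quartic form having invariants `I` and `J`.
Suppose that `3⁵ ∣ I`, `3⁹ ∣ J` and `z² = f(x,y)` has a solution in `ℚ₃`. Then there exists an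
integral binary quartic form `f'` equivalent to `f` having invariants `3⁻⁴I` and `3⁻⁶J`."
[cite: BhargavaShankarAnnals2015, Lemma 5.4 (arXiv:1006.1002v2 numbering)] -/
def bsd_minimisation_three : Prop :=
  ∀ f : BinaryQuartic ℤ,
    (3 : ℤ) ^ 5 ∣ f.I → (3 : ℤ) ^ 9 ∣ f.J → (f.map (Int.castRingHom ℚ_[3])).IsSoluble →
      ∃ f' : BinaryQuartic ℤ,
        KEquiv (f.map (Int.castRingHom ℚ)) (f'.map (Int.castRingHom ℚ)) ∧
          (3 : ℤ) ^ 4 * f'.I = f.I ∧ (3 : ℤ) ^ 6 * f'.J = f.J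

/-- **Minimisation at `2`** (Bhargava–Shankar, held arXiv text, Lemma 5.5 = Birch–Swinnerton-Dyer
(1963), Lemma 5): "Let `f` be an integral binary quartic form having invariants `I` and `J`.
Suppose that `2⁶ ∣ I`, `2⁹ ∣ J`, `2¹⁰ ∣ (8I + J)`, and `z² = g(x,y)` [sic; `f`] has a solution in
`ℚ₂`. Then there exists an integral binary quartic form `f'` equivalent to `f` having invariants
`2⁻⁴I` and `2⁻⁶J`." [cite: BhargavaShankarAnnals2015, Lemma 5.5 (arXiv:1006.1002v2 numbering)] -/
def bsd_minimisation_two : Prop :=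
  ∀ f : BinaryQuartic ℤ,
    (2 : ℤ) ^ 6 ∣ f.I → (2 : ℤ) ^ 9 ∣ f.J → (2 : ℤ) ^ 10 ∣ 8 * f.I + f.J →
      (f.map (Int.castRingHom ℚ_[2])).IsSoluble →
      ∃ f' : BinaryQuartic ℤ,
        KEquiv (f.map (Int.castRingHom ℚ)) (f'.map (Int.castRingHom ℚ)) ∧
          (2 : ℤ) ^ 4 * f'.I = f.I ∧ (2 : ℤ) ^ 6 * f'.J = f.J

end Literature.NumberTheory.EllipticCurves

end
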